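import Summits.QuantumFields.YangMills.Theorems.BalabanUVNodesN19SmoothLinkFirstOrder
import Summits.QuantumFields.YangMills.Theorems.BalabanUVNodesN19JointLawPriceCompositionsLipschitz
import Summits.QuantumFields.YangMills.Theorems.BalabanUVNodesN19JacksonAbsolutePowers

/-!
# YM-DAG node N19 (= NE7 proper) — THE LADDER FOR A GENERAL ADDITIVE LIPSCHITZ STATISTIC `T(x) = Σ_i φ_i(x_i)`
# (module 151 §1 with `|x_i|` replaced by any `1`-Lipschitz `φ_i : [−1,1] → [0,1]`: one `A_J` for all frequencies)

Cell `pub-ymgap`, HUMAN RULING D-0062 (Track A) ∕ D-0149 (work-bound push), R141 (C) wider-strategy seat `pub-ymgap-dag-n19-e` (strategy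
s3 = ALTERNATIVE CURRENCY), generation g33, module 11 (lineage module 158).  Route `Summits/QuantumFields/YangMills/Theses/BalabanUVNodes.lean`,
cluster item K3⁸ «SpineGivenEndpointR13SepCoPHV» (stmt-QuantumFields-27366); filed `--supports` that item `--as helper` (it proves no registered
stub).  COUNT-NEUTRAL: [folklore]∕[bookkeeping] over Mathlib and the lineage BY NAME — module 118 (`exists_pair_near_cexp_sum`, the ladder engine),
module 111 (`exists_jacksonPoly_near`: the Jackson polynomial of a Lipschitz function of one variable), module 117 (`eval_plantIn`,
`totalDegree_plantIn_le`); no laws, no scheme object, no Theses import; NOT a discharge claim.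

ROLE IN THE LINEAGE.  CURRENCY-MAP v7's conjecture was stated for compositions `h(Σ_iφ_i(x_i))` with Lipschitz inner functions `φ_i`, not only for
`φ = |·|`; modules 150–153 settled `φ = |·|` (every Lipschitz link at `d·log³t∕t`).  The proof used `|·|` only through (i) the additive Jackson
approximant of `Σ|x_i|` (module 119) and (ii) `Σ|x_i| ∈ [0, d]`.  This module supplies both for ANY family `φ_i : ℝ → ℝ` that is `1`-Lipschitz with
values in `[0, 1]` on `[−1, 1]` (the general case `K_φ`-Lipschitz, `G_φ`-bounded reduces to it by the affine rescaling `ψ_i = (φ_i + c)∕2c`,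
`c = max(K_φ, G_φ)`, at the price `Lip h ↦ 2c·Lip h`): §0 `exists_additiveJackson_of_lipschitz` (`A_M = Σ_i q^{(i)}_M(X_i)`, degree `2M`,
`|T − A_M| ≤ dπ∕M`), `abs_additive_sub_half_le` (`|T − d∕2| ≤ d∕2`), `additive_mem_Icc`, `continuous_additive`; §1
`exists_ladder_pairs_near_cexp_additive_uniform` — module 151 §1 VERBATIM for `T`: ONE `A_J` and, for every `ω ≥ 0`, a pair within `2(J+1)e^{−h}` of
`e^{iωA_J}` at degree `2e²ωd(½ + π + 3πJ) + 2h(2^{J+1} − 1)`.  The sequel (`…N19AdditiveLinksFirstOrder` ∕ `…DegreeBudget`) runs modules 151 §3 and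
152b for `T`: every `K`-Lipschitz link of every such additive statistic at `10⁴·K·d·log₂³t∕t`.

HONEST FRAMING (binding).  Elementary and [folklore]; NO consumer in the DAG today (the seat's own currency map, degree model); nothing of Bałaban's
instantiated; NE7 NOT PRINTED, NOT proved; N19 NOT discharged; count-neutral.  One finite `T⁴` programme at fixed `ε`; nothing continuum ∕ `ℝ⁴` ∕ OS ∕
mass-gap ∕ Clay.  0 `def` ∕ 0 `sorry`.
-/

noncomputable section

open Finset Complex Polynomial
open scoped Real

namespace Summit.QuantumFields.YangMills.Theorems.BalabanUVNodesN19AdditiveLinksLadder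

open Summit.QuantumFields.YangMills.Theorems.BalabanUVNodesN19SingleModeMultiscale (exists_pair_near_cexp_sum)
open Summit.QuantumFields.YangMills.Theorems.BalabanUVNodesN19JointLawPriceCompositionsLipschitz (exists_jacksonPoly_near)
open Summit.QuantumFields.YangMills.Theorems.BalabanUVNodesN19JacksonAbsolutePowers (eval_plantIn totalDegree_plantIn_le)

variable {ι : Type*} [Fintype ι]
variable {φ : ι → ℝ → ℝ}
  (hφL : ∀ i, ∀ u v : ℝ, u ∈ Set.Icc (-1 : ℝ) 1 → v ∈ Set.Icc (-1 : ℝ) 1 → |φ i u - φ i v| ≤ 1 * |u - v|)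
  (hφ0 : ∀ i, ∀ u : ℝ, u ∈ Set.Icc (-1 : ℝ) 1 → 0 ≤ φ i u) (hφ1 : ∀ i, ∀ u : ℝ, u ∈ Set.Icc (-1 : ℝ) 1 → φ i u ≤ 1)

/-! ## §0 The additive Jackson approximant of `Σ_i φ_i(x_i)` [folklore] -/

include hφL hφ0 hφ1 in
/-- **THE ADDITIVE JACKSON APPROXIMANT OF `T = Σ_i φ_i(x_i)`.**  For `1`-Lipschitz `φ_i : [−1,1] → [0,1]` and `M ≥ 1` there is a real `MvPolynomial`
`A_M = Σ_i q^{(i)}_M(X_i)` of total degree `≤ 2M` with `|Σ_iφ_i(x_i) − A_M(x)| ≤ d·π∕M` on `[−1,1]^ι` (`d = |ι|`; module 111's Jackson polynomial of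
each `φ_i` planted in its coordinate). [folklore] -/
theorem exists_additiveJackson_of_lipschitz {M : ℕ} (hM : 0 < M) :
    ∃ A : MvPolynomial ι ℝ, A.totalDegree ≤ 2 * M ∧
      ∀ x : ι → ℝ, (∀ i, x i ∈ Set.Icc (-1 : ℝ) 1) →
        |(∑ i, φ i (x i)) - MvPolynomial.eval x A| ≤ Fintype.card ι * (π / M) := by
  have hG : ∀ i, ∀ u : ℝ, u ∈ Set.Icc (-1 : ℝ) 1 → |φ i u| ≤ 1 := fun i u hu => by
    rw [abs_of_nonneg (hφ0 i u hu)]; exact hφ1 i u hu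
  choose q hqdeg hqerr using fun i => exists_jacksonPoly_near zero_le_one (hφL i) (hG i) hM
  refine ⟨∑ i, ∑ k ∈ range ((q i).natDegree + 1), MvPolynomial.C ((q i).coeff k) * (MvPolynomial.X i) ^ k, ?_, ?_⟩
  · refine MvPolynomial.totalDegree_finsetSum_le fun i _ => (totalDegree_plantIn_le (q i) _).trans ?_
    rw [MvPolynomial.totalDegree_X, mul_one]; exact hqdeg i
  · intro x hx
    have hsum : MvPolynomial.eval x (∑ i, ∑ k ∈ range ((q i).natDegree + 1), MvPolynomial.C ((q i).coeff k) * (MvPolynomial.X i) ^ k) =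
        ∑ i, (q i).eval (x i) := by
      rw [map_sum]
      exact Finset.sum_congr rfl fun i _ => by rw [eval_plantIn, MvPolynomial.eval_X]
    rw [hsum, ← Finset.sum_sub_distrib]
    calc |∑ i, (φ i (x i) - (q i).eval (x i))| ≤ ∑ i, |φ i (x i) - (q i).eval (x i)| := abs_sum_le_sum_abs _ _
      _ ≤ ∑ _i : ι, 1 * (π / M) := Finset.sum_le_sum fun i _ => (hqerr i).1 _ (hx i)
      _ = Fintype.card ι * (π / M) := by rw [sum_const, card_univ, nsmul_eq_mul, one_mul]

include hφ0 hφ1 in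
/-- `T = Σ_iφ_i(x_i)` lies in `[0, d]` on the cube: `|T − d∕2| ≤ d∕2`. [bookkeeping] -/
theorem abs_additive_sub_half_le (x : ι → ℝ) (hx : ∀ i, x i ∈ Set.Icc (-1 : ℝ) 1) :
    |(∑ i, φ i (x i)) - Fintype.card ι / 2| ≤ Fintype.card ι / 2 := by
  have h0 : 0 ≤ ∑ i, φ i (x i) := Finset.sum_nonneg fun i _ => hφ0 i _ (hx i)
  have h1 : ∑ i, φ i (x i) ≤ Fintype.card ι := by
    calc ∑ i, φ i (x i) ≤ ∑ _i : ι, (1 : ℝ) := Finset.sum_le_sum fun i _ => hφ1 i _ (hx i)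
      _ = Fintype.card ι := by rw [sum_const, card_univ, nsmul_eq_mul, mul_one]
  rw [abs_le]; constructor <;> linarith

include hφ0 hφ1 in
/-- `T = Σ_iφ_i(x_i) ∈ [0, d]` on the cube. [bookkeeping] -/
theorem additive_mem_Icc (x : ι → ℝ) (hx : ∀ i, x i ∈ Set.Icc (-1 : ℝ) 1) :
    0 ≤ ∑ i, φ i (x i) ∧ ∑ i, φ i (x i) ≤ Fintype.card ι := by
  have h := abs_le.1 (abs_additive_sub_half_le hφ0 hφ1 x hx)
  constructor <;> linarith [h.1, h.2]

/-! ## §1 One ladder for all frequencies, general additive statistic [folklore] -/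

include hφL hφ0 hφ1 in
/-- **ONE LADDER FOR ALL FREQUENCIES, FOR `T = Σ_iφ_i(x_i)`.**  For `1`-Lipschitz `φ_i : [−1,1] → [0,1]`, `J : ℕ` and `h ≥ 1` with `(J+1)e^{−h} ≤ ½`
there is `A` (`= A_J`, `deg A ≤ 2^{J+1}`, `|T − A| ≤ dπ∕2^J` on the cube) such that for EVERY `ω ≥ 0` there is a pair `(Cr, Ci)` of total degree
`≤ 2e²ωd(½ + π + 3πJ) + 2h(2^{J+1} − 1)` with `‖Cr(x) + Ci(x)·i − e^{iωA(x)}‖ ≤ 2(J+1)e^{−h}` on `[−1,1]^ι` — module 151 §1 verbatim with §0's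
approximants. [folklore] -/
theorem exists_ladder_pairs_near_cexp_additive_uniform (J h : ℕ) (hh : 1 ≤ h)
    (hJh : ((J : ℝ) + 1) * Real.exp (-(h : ℝ)) ≤ 1 / 2) :
    ∃ A : MvPolynomial ι ℝ, A.totalDegree ≤ 2 * 2 ^ J ∧
      (∀ x : ι → ℝ, (∀ i, x i ∈ Set.Icc (-1 : ℝ) 1) → |(∑ i, φ i (x i)) - MvPolynomial.eval x A| ≤ Fintype.card ι * π / 2 ^ J) ∧
      ∀ ω : ℝ, 0 ≤ ω → ∃ Cr Ci : MvPolynomial ι ℝ,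
        (Cr.totalDegree : ℝ) ≤ 2 * Real.exp 2 * ω * Fintype.card ι * (1 / 2 + π + 3 * π * J) + 2 * h * (2 ^ (J + 1) - 1) ∧
        (Ci.totalDegree : ℝ) ≤ 2 * Real.exp 2 * ω * Fintype.card ι * (1 / 2 + π + 3 * π * J) + 2 * h * (2 ^ (J + 1) - 1) ∧
        ∀ x : ι → ℝ, (∀ i, x i ∈ Set.Icc (-1 : ℝ) 1) →
          ‖((MvPolynomial.eval x Cr : ℝ) : ℂ) + ((MvPolynomial.eval x Ci : ℝ) : ℂ) * I -
              exp (((ω * MvPolynomial.eval x A : ℝ) : ℂ) * I)‖ ≤ 2 * ((J : ℝ) + 1) * Real.exp (-(h : ℝ)) := by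
  set d : ℝ := (Fintype.card ι : ℝ) with hd
  have hd0 : 0 ≤ d := Nat.cast_nonneg _
  -- the Jackson ladder (chosen once, for all frequencies)
  choose A hAdeg hAerr using fun l : ℕ => exists_additiveJackson_of_lipschitz hφL hφ0 hφ1 (M := 2 ^ l) (pow_pos two_pos l)
  obtain ⟨A', hA'0, hA's⟩ : ∃ A' : ℕ → MvPolynomial ι ℝ, A' 0 = MvPolynomial.C (d / 2) ∧ ∀ l, A' (l + 1) = A l :=
    ⟨fun l => if l = 0 then MvPolynomial.C (d / 2) else A (l - 1), if_pos rfl, fun l => by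
      show (if l + 1 = 0 then MvPolynomial.C (d / 2) else A (l + 1 - 1)) = A l
      rw [if_neg (Nat.succ_ne_zero l), Nat.add_sub_cancel]⟩
  obtain ⟨B, hB⟩ : ∃ B : ℕ → MvPolynomial ι ℝ, ∀ l, B l = A l - A' l := ⟨fun l => A l - A' l, fun l => rfl⟩
  obtain ⟨R, hR0', hRs⟩ : ∃ R : ℕ → ℝ, R 0 = d * (1 / 2 + π) ∧ ∀ l, R (l + 1) = 3 * d * π / 2 ^ (l + 1) :=
    ⟨fun l => if l = 0 then d * (1 / 2 + π) else 3 * d * π / 2 ^ l, if_pos rfl, fun l => if_neg (Nat.succ_ne_zero l)⟩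
  obtain ⟨m, hm⟩ : ∃ m : ℕ → ℕ, ∀ l, m l = 2 * 2 ^ l := ⟨fun l => 2 * 2 ^ l, fun l => rfl⟩
  have hR0 : ∀ l, 0 ≤ R l := fun l => by cases l with | zero => rw [hR0']; positivity | succ l => rw [hRs]; positivity
  have hdegB : ∀ l, l < J + 1 → (B l).totalDegree ≤ m l := by
    intro l _
    rw [hB, hm]
    refine (MvPolynomial.totalDegree_sub _ _).trans (max_le ((hAdeg l).trans le_rfl) ?_)
    cases l with
    | zero => rw [hA'0, MvPolynomial.totalDegree_C]; exact Nat.zero_le _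
    | succ l =>
      rw [hA's]
      exact (hAdeg l).trans (Nat.mul_le_mul_left _ (Nat.pow_le_pow_right two_pos (Nat.le_succ l)))
  have hRB : ∀ l, l < J + 1 → ∀ x : ι → ℝ, (∀ i, x i ∈ Set.Icc (-1 : ℝ) 1) → |MvPolynomial.eval x (B l)| ≤ R l := by
    intro l _ x hx
    rw [hB, map_sub]
    cases l with
    | zero =>
      rw [hA'0, hR0', MvPolynomial.eval_C]
      have h1 := hAerr 0 x hx
      have h2 := abs_additive_sub_half_le hφ0 hφ1 x hx
      rw [pow_zero, Nat.cast_one, div_one] at h1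
      calc |MvPolynomial.eval x (A 0) - d / 2|
          ≤ |MvPolynomial.eval x (A 0) - (∑ i, φ i (x i))| + |(∑ i, φ i (x i)) - d / 2| := abs_sub_le _ _ _
        _ ≤ d * π + d / 2 := by rw [abs_sub_comm] at h1; exact add_le_add h1 h2
        _ = d * (1 / 2 + π) := by ring
    | succ l =>
      rw [hA's, hRs]
      have h1 := hAerr (l + 1) x hx
      have h2 := hAerr l x hx
      calc |MvPolynomial.eval x (A (l + 1)) - MvPolynomial.eval x (A l)|
          ≤ |MvPolynomial.eval x (A (l + 1)) - (∑ i, φ i (x i))| + |(∑ i, φ i (x i)) - MvPolynomial.eval x (A l)| := abs_sub_le _ _ _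
        _ ≤ d * (π / (2 ^ (l + 1) : ℕ)) + d * (π / (2 ^ l : ℕ)) := by rw [abs_sub_comm] at h1; exact add_le_add h1 h2
        _ = 3 * d * π / 2 ^ (l + 1) := by push_cast; rw [pow_succ]; field_simp; ring
  -- degree bookkeeping of the increments (independent of `ω`)
  have hRm0 : R 0 * (m 0 : ℝ) = 2 * d * (1 / 2 + π) := by rw [hR0', hm]; push_cast; ring
  have hRms : ∀ l, R (l + 1) * (m (l + 1) : ℝ) = 6 * d * π := by
    intro l
    rw [hRs, hm]; push_cast
    have h2 : (2 : ℝ) ^ (l + 1) ≠ 0 := pow_ne_zero _ two_ne_zero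
    field_simp; ring
  have hsumRm : ∑ l ∈ range (J + 1), R l * (m l : ℝ) = 2 * d * (1 / 2 + π) + 6 * d * π * J := by
    rw [Finset.sum_range_succ', hRm0, Finset.sum_congr rfl fun l _ => hRms l, sum_const, card_range, nsmul_eq_mul]
    ring
  have hsumm : ∑ l ∈ range (J + 1), (m l : ℝ) = 2 * (2 ^ (J + 1) - 1) := by
    have hg := geom_sum_eq (x := (2 : ℝ)) (by norm_num) (J + 1)
    rw [Finset.sum_congr rfl fun l _ => show (m l : ℝ) = 2 * 2 ^ l by rw [hm]; push_cast; ring, ← Finset.mul_sum, hg]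
    ring
  -- the telescoping identity (independent of `ω`)
  have hsumB : ∀ x : ι → ℝ, ∑ l ∈ range (J + 1), MvPolynomial.eval x (B l) = MvPolynomial.eval x (A J) - d / 2 := by
    intro x
    have hsub : ∀ l, MvPolynomial.eval x (B l) = MvPolynomial.eval x (A l) - MvPolynomial.eval x (A' l) := fun l => by
      rw [hB, map_sub]
    simp only [hsub, Finset.sum_sub_distrib]
    rw [Finset.sum_range_succ (fun l => MvPolynomial.eval x (A l)), Finset.sum_range_succ' (fun l => MvPolynomial.eval x (A' l))]
    have hxA'0 : MvPolynomial.eval x (A' 0) = d / 2 := by rw [hA'0, MvPolynomial.eval_C]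
    have hxA's : ∀ l, MvPolynomial.eval x (A' (l + 1)) = MvPolynomial.eval x (A l) := fun l => by rw [hA's]
    simp only [hxA'0, hxA's]
    ring
  refine ⟨A J, hAdeg J, fun x hx => (hAerr J x hx).trans_eq (by push_cast; ring), fun ω hω => ?_⟩
  -- the Taylor orders for this `ω`
  obtain ⟨n, hn⟩ : ∃ n : ℕ → ℕ, ∀ l, n l = ⌈Real.exp 2 * (ω * R l)⌉₊ + h := ⟨fun l => ⌈Real.exp 2 * (ω * R l)⌉₊ + h, fun l => rfl⟩
  have hnl : ∀ l, l < J + 1 → 1 ≤ n l ∧ Real.exp 2 * (ω * R l) ≤ n l := by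
    intro l _
    rw [hn]
    refine ⟨hh.trans (Nat.le_add_left h _), ?_⟩
    push_cast
    exact (Nat.le_ceil _).trans (le_add_of_nonneg_right (Nat.cast_nonneg _))
  have hηl : ∀ l, Real.exp (ω * R l - n l) ≤ Real.exp (-(h : ℝ)) := by
    intro l
    refine Real.exp_le_exp.2 ?_
    rw [hn]; push_cast
    have h1 : ω * R l ≤ Real.exp 2 * (ω * R l) := by
      have : (1 : ℝ) ≤ Real.exp 2 := Real.one_le_exp (by norm_num)
      nlinarith [mul_nonneg hω (hR0 l)]
    have h2 := Nat.le_ceil (Real.exp 2 * (ω * R l))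
    linarith
  have hηsum : ∑ l ∈ range (J + 1), Real.exp (ω * R l - n l) ≤ ((J : ℝ) + 1) * Real.exp (-(h : ℝ)) := by
    calc ∑ l ∈ range (J + 1), Real.exp (ω * R l - n l) ≤ ∑ _l ∈ range (J + 1), Real.exp (-(h : ℝ)) :=
          Finset.sum_le_sum fun l _ => hηl l
      _ = ((J : ℝ) + 1) * Real.exp (-(h : ℝ)) := by rw [sum_const, card_range, nsmul_eq_mul]; push_cast; ring
  -- the ladder
  obtain ⟨Cr, Ci, hCr, hCi, happ⟩ := exists_pair_near_cexp_sum (ι := ι) (ω * (d / 2)) hω B m n R (J + 1) hdegB hRB hnl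
    (hηsum.trans hJh)
  have hdeg : ((∑ l ∈ range (J + 1), (n l - 1) * m l : ℕ) : ℝ) ≤
      2 * Real.exp 2 * ω * d * (1 / 2 + π + 3 * π * J) + 2 * h * (2 ^ (J + 1) - 1) := by
    push_cast
    have hterm : ∀ l ∈ range (J + 1), (((n l - 1 : ℕ) : ℝ)) * (m l : ℝ) ≤ (Real.exp 2 * ω) * (R l * m l) + h * (m l : ℝ) := by
      intro l hl
      have hn1 : 1 ≤ n l := (hnl l (mem_range.1 hl)).1
      have hcast : ((n l - 1 : ℕ) : ℝ) = (⌈Real.exp 2 * (ω * R l)⌉₊ : ℝ) + h - 1 := by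
        rw [Nat.cast_sub hn1, hn]; push_cast; ring
      have hceil : (⌈Real.exp 2 * (ω * R l)⌉₊ : ℝ) < Real.exp 2 * (ω * R l) + 1 :=
        Nat.ceil_lt_add_one (mul_nonneg (Real.exp_pos _).le (mul_nonneg hω (hR0 l)))
      have hm0 : (0 : ℝ) ≤ m l := Nat.cast_nonneg _
      rw [hcast]
      nlinarith
    calc ∑ l ∈ range (J + 1), ((n l - 1 : ℕ) : ℝ) * (m l : ℝ)
        ≤ ∑ l ∈ range (J + 1), ((Real.exp 2 * ω) * (R l * m l) + h * (m l : ℝ)) := Finset.sum_le_sum hterm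
      _ = (Real.exp 2 * ω) * ∑ l ∈ range (J + 1), R l * (m l : ℝ) + h * ∑ l ∈ range (J + 1), (m l : ℝ) := by
          rw [Finset.sum_add_distrib, Finset.mul_sum, Finset.mul_sum]
      _ = 2 * Real.exp 2 * ω * d * (1 / 2 + π + 3 * π * J) + 2 * h * (2 ^ (J + 1) - 1) := by
          rw [hsumRm, hsumm]; ring
  refine ⟨Cr, Ci, (Nat.cast_le.2 hCr).trans hdeg, (Nat.cast_le.2 hCi).trans hdeg, fun x hx => ?_⟩
  have htel : ω * (d / 2) + ω * ∑ l ∈ range (J + 1), MvPolynomial.eval x (B l) = ω * MvPolynomial.eval x (A J) := by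
    rw [hsumB]; ring
  have happ' := happ x hx
  rw [htel] at happ'
  exact happ'.trans (by nlinarith [hηsum, Real.exp_pos (-(h : ℝ))])

end Summit.QuantumFields.YangMills.Theorems.BalabanUVNodesN19AdditiveLinksLadder

end
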